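import Mathlib
import Summits.Ventures.HodgeRepro2.T5RamificationIndexGlobal
import Summits.Ventures.HodgeRepro2.T5RamificationIndexUniformizer
import Summits.Ventures.HodgeRepro2.T5RamifiedQuadraticDictionary
import Summits.Ventures.HodgeRepro2.T5AdicCompletionResidueField
import Summits.Ventures.HodgeRepro2.T5AdicCompletionHenselian
import Summits.Ventures.HodgeRepro2.T5ContinuousValuationExtension

/-!
# THE FUNDAMENTAL IDENTITY FOR COMPLETIONS: `[L_w : K_v] = e(w∣v) · f(w∣v)` (T5CompletionFundamentalIdentity)

Row 65 (T5RamifiedQuadraticDictionary) proves `e' · f' = [L_w : K_v]` for the LOCAL indices of the DVR pair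
`O_{K_v} ⊆ O_{L_w}` (`e' = (ϖ).ramificationIdx' (π)`, `f' = (ϖ).inertiaDeg' (π)`). Here the local indices are identified
with Mathlib's GLOBAL ones: `e' = e(w∣v) := v.asIdeal.ramificationIdx' w.asIdeal` (p412826: the valuation exponent of
`alg ϖ` is the global ramification index) and `f' = f(w∣v) := v.asIdeal.inertiaDeg' w.asIdeal` (row 77's residue-field
isomorphisms `𝓞_K/v ≃ 𝓀(O_{K_v})`, `𝓞_L/w ≃ 𝓀(O_{L_w})` are compatible with the residue extensions). Hence
`[L_w : K_v] = e(w∣v) · f(w∣v)` — the degree of a completion read off Mathlib's global ramification data, the hypothesis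
`h2` of the chain for ANY non-split place of a quadratic extension (`e f = 2`).

No axiom beyond the standard trio; nothing of the scored record changes.
§8(d): uses an L-value-free non-vanishing device: NO.
-/

namespace Summit.Ventures.HodgeRepro2.T5CompletionFundamentalIdentity

open IsDedekindDomain HeightOneSpectrum NumberField

variable {K : Type*} [Field K] [NumberField K] (v : HeightOneSpectrum (NumberField.RingOfIntegers K))
  {L : Type*} [Field L] [NumberField L] [Algebra K L] (w : HeightOneSpectrum (NumberField.RingOfIntegers L))
  [w.asIdeal.LiesOver v.asIdeal]

/-! ### `e' = e(w∣v)` -/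

/-- `alg ϖ ≠ 0` in `O_{L_w}` for `ϖ ≠ 0`. -/
theorem algebraMap_ne_zero {ϖ : v.adicCompletionIntegers K} (hϖ : ϖ ≠ 0) :
    algebraMap (v.adicCompletionIntegers K) (w.adicCompletionIntegers L) ϖ ≠ 0 := by
  intro h
  have h' := congrArg (fun x : w.adicCompletionIntegers L => (x : w.adicCompletion L)) h
  rw [Summit.Ventures.HodgeRepro2.T5ContinuousValuationExtension.coe_algebraMap_adicCompletionIntegers,
    ZeroMemClass.coe_zero, map_eq_zero] at h'
  exact hϖ (Subtype.ext h')

/-- THE LOCAL RAMIFICATION INDEX IS THE GLOBAL ONE: `(ϖ).ramificationIdx' (π) = e(w∣v)` for uniformisers `ϖ`, `π`. -/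
theorem ramificationIdx'_span_eq {ϖ : v.adicCompletionIntegers K} (hϖ : Irreducible ϖ)
    {π : w.adicCompletionIntegers L} (hπ : Irreducible π) :
    (Ideal.span {ϖ}).ramificationIdx' (Ideal.span {π}) = v.asIdeal.ramificationIdx' w.asIdeal := by
  obtain ⟨u, hu⟩ := Summit.Ventures.HodgeRepro2.T5RamificationIndexUniformizer.exists_unit_algebraMap_eq_mul_pow_ramificationIdx'
    ϖ (algebraMap_ne_zero v w hϖ.ne_zero) π hπ
  -- the valuation of `alg ϖ` two ways
  have h1 : Valued.v ((algebraMap (v.adicCompletionIntegers K) (w.adicCompletionIntegers L) ϖ :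
      w.adicCompletionIntegers L) : w.adicCompletion L) =
      WithZero.exp (-1) ^ ((Ideal.span {ϖ}).ramificationIdx' (Ideal.span {π})) := by
    rw [hu]
    push_cast
    rw [map_mul, map_pow, Summit.Ventures.HodgeRepro2.T5AdicCompletionHenselian.val_coe_units_eq_one w u, one_mul,
      (Summit.Ventures.HodgeRepro2.T5AdicCompletionConductor.irreducible_iff_val_eq_exp_neg_one w π).mp hπ]
  have h2 : Valued.v ((algebraMap (v.adicCompletionIntegers K) (w.adicCompletionIntegers L) ϖ :
      w.adicCompletionIntegers L) : w.adicCompletion L) =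
      WithZero.exp (-1) ^ (v.asIdeal.ramificationIdx' w.asIdeal) := by
    rw [Summit.Ventures.HodgeRepro2.T5ContinuousValuationExtension.coe_algebraMap_adicCompletionIntegers,
      Summit.Ventures.HodgeRepro2.T5RamificationIndexGlobal.val_algebraMap_eq_pow_ramificationIdx,
      (Summit.Ventures.HodgeRepro2.T5AdicCompletionConductor.irreducible_iff_val_eq_exp_neg_one v ϖ).mp hϖ]
  rw [h1, ← WithZero.exp_nsmul, ← WithZero.exp_nsmul, WithZero.exp_inj] at h2
  simp only [nsmul_eq_mul] at h2
  omega

/-! ### `f' = f(w∣v)` -/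

/-- `alg ϖ` is not a unit of `O_{L_w}` (its valuation is `exp(−e(w∣v))`, `e(w∣v) ≥ 1`). -/
theorem not_isUnit_algebraMap {ϖ : v.adicCompletionIntegers K} (hϖ : Irreducible ϖ) :
    ¬ IsUnit (algebraMap (v.adicCompletionIntegers K) (w.adicCompletionIntegers L) ϖ) := by
  rw [IsDedekindDomain.HeightOneSpectrum.adicCompletionIntegers.isUnit_iff_valued_eq_one]
  change Valued.v ((algebraMap (v.adicCompletionIntegers K) (w.adicCompletionIntegers L) ϖ :
    w.adicCompletionIntegers L) : w.adicCompletion L) ≠ 1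
  rw [Summit.Ventures.HodgeRepro2.T5ContinuousValuationExtension.coe_algebraMap_adicCompletionIntegers,
    Summit.Ventures.HodgeRepro2.T5RamificationIndexGlobal.val_algebraMap_eq_pow_ramificationIdx,
    (Summit.Ventures.HodgeRepro2.T5AdicCompletionConductor.irreducible_iff_val_eq_exp_neg_one v ϖ).mp hϖ,
    ← WithZero.exp_nsmul, ← WithZero.exp_zero, Ne, WithZero.exp_inj, nsmul_eq_mul]
  have := Summit.Ventures.HodgeRepro2.T5RamificationIndexGlobal.ramificationIdx'_ne_zero v w
  omega

/-- The contraction of `(π)` to `O_{K_v}` is `(ϖ)` (`(π)` is the maximal ideal of `O_{L_w}`; its contraction is a non-zero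
prime of the discrete valuation ring `O_{K_v}`, hence its unique non-zero prime `(ϖ)`). -/
theorem comap_span_eq {ϖ : v.adicCompletionIntegers K} (hϖ : Irreducible ϖ)
    {π : w.adicCompletionIntegers L} (hπ : Irreducible π) :
    Ideal.comap (algebraMap (v.adicCompletionIntegers K) (w.adicCompletionIntegers L)) (Ideal.span {π}) =
      Ideal.span {ϖ} := by
  rw [← hπ.maximalIdeal_eq, ← hϖ.maximalIdeal_eq]
  obtain ⟨-, P₀, hP₀, huniq⟩ :=
    (IsDiscreteValuationRing.iff_pid_with_one_nonzero_prime (v.adicCompletionIntegers K)).mp inferInstance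
  have h1 : Ideal.comap (algebraMap (v.adicCompletionIntegers K) (w.adicCompletionIntegers L))
      (IsLocalRing.maximalIdeal (w.adicCompletionIntegers L)) ≠ ⊥ ∧
      (Ideal.comap (algebraMap (v.adicCompletionIntegers K) (w.adicCompletionIntegers L))
      (IsLocalRing.maximalIdeal (w.adicCompletionIntegers L))).IsPrime := by
    refine ⟨?_, Ideal.comap_isPrime _ _⟩
    intro hbot
    have hmem : ϖ ∈ Ideal.comap (algebraMap (v.adicCompletionIntegers K) (w.adicCompletionIntegers L))
        (IsLocalRing.maximalIdeal (w.adicCompletionIntegers L)) := by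
      rw [Ideal.mem_comap]
      exact (IsLocalRing.mem_maximalIdeal _).mpr (not_isUnit_algebraMap v w hϖ)
    rw [hbot, Ideal.mem_bot] at hmem
    exact hϖ.ne_zero hmem
  have h2 : IsLocalRing.maximalIdeal (v.adicCompletionIntegers K) ≠ ⊥ ∧
      (IsLocalRing.maximalIdeal (v.adicCompletionIntegers K)).IsPrime := by
    refine ⟨?_, (IsLocalRing.maximalIdeal.isMaximal _).isPrime⟩
    rw [hϖ.maximalIdeal_eq]
    intro hbot
    have := Ideal.mem_span_singleton_self ϖ
    rw [hbot, Ideal.mem_bot] at this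
    exact hϖ.ne_zero this
  rw [huniq _ h1, huniq _ h2]

/-- `alg` maps the maximal ideal of `O_{K_v}` into the maximal ideal of `O_{L_w}` (`v(alg x) = v(x)^{e} < 1`). -/
theorem algebraMap_mem_maximalIdeal {x : v.adicCompletionIntegers K}
    (hx : x ∈ IsLocalRing.maximalIdeal (v.adicCompletionIntegers K)) :
    algebraMap (v.adicCompletionIntegers K) (w.adicCompletionIntegers L) x ∈
      IsLocalRing.maximalIdeal (w.adicCompletionIntegers L) := by
  rw [IsLocalRing.mem_maximalIdeal, mem_nonunits_iff,
    IsDedekindDomain.HeightOneSpectrum.adicCompletionIntegers.isUnit_iff_valued_eq_one] at hx ⊢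
  change Valued.v ((algebraMap (v.adicCompletionIntegers K) (w.adicCompletionIntegers L) x :
    w.adicCompletionIntegers L) : w.adicCompletion L) ≠ 1
  rw [Summit.Ventures.HodgeRepro2.T5ContinuousValuationExtension.coe_algebraMap_adicCompletionIntegers,
    Summit.Ventures.HodgeRepro2.T5RamificationIndexGlobal.val_algebraMap_eq_pow_ramificationIdx]
  have hle : Valued.v (x : v.adicCompletion K) ≤ 1 :=
    (IsDedekindDomain.HeightOneSpectrum.mem_adicCompletionIntegers _ _ _).mp x.2
  have hlt : Valued.v (x : v.adicCompletion K) < 1 := lt_of_le_of_ne hle hx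
  have hne := Summit.Ventures.HodgeRepro2.T5RamificationIndexGlobal.ramificationIdx'_ne_zero v w
  exact ne_of_lt (pow_lt_one₀ zero_le hlt hne)

/-- The integer-level tower: `alg (alg_{𝓞_K → O_{K_v}} r) = alg_{𝓞_L → O_{L_w}} (alg_{𝓞_K → 𝓞_L} r)`. -/
theorem algebraMap_algebraMap_ringOfIntegers (r : NumberField.RingOfIntegers K) :
    algebraMap (v.adicCompletionIntegers K) (w.adicCompletionIntegers L)
      (algebraMap (NumberField.RingOfIntegers K) (v.adicCompletionIntegers K) r) =
    algebraMap (NumberField.RingOfIntegers L) (w.adicCompletionIntegers L)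
      (algebraMap (NumberField.RingOfIntegers K) (NumberField.RingOfIntegers L) r) := by
  apply Subtype.ext
  change ((algebraMap (v.adicCompletionIntegers K) (w.adicCompletionIntegers L)
    (algebraMap (NumberField.RingOfIntegers K) (v.adicCompletionIntegers K) r) : w.adicCompletionIntegers L) :
    w.adicCompletion L) = algebraMap L (w.adicCompletion L) (algebraMap (NumberField.RingOfIntegers L) L
      (algebraMap (NumberField.RingOfIntegers K) (NumberField.RingOfIntegers L) r))
  rw [Summit.Ventures.HodgeRepro2.T5ContinuousValuationExtension.coe_algebraMap_adicCompletionIntegers]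
  change algebraMap (v.adicCompletion K) (w.adicCompletion L)
    (algebraMap K (v.adicCompletion K) (algebraMap (NumberField.RingOfIntegers K) K r)) = _
  rw [Summit.Ventures.HodgeRepro2.T5RamificationIndexGlobal.algebraMap_algebraMap,
    Summit.Ventures.HodgeRepro2.T5AdicCompletionMap.algebraMap_K_L_eq (R := NumberField.RingOfIntegers K) (K := K)
      (L := L) (NumberField.RingOfIntegers L) r]

/-- Residues are compatible with the integer-level tower: if `residue a = residueMap r` in `𝓀(O_{K_v})` then
`residue (alg a) = residueMap (alg r)` in `𝓀(O_{L_w})`. -/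
theorem residue_algebraMap (a : v.adicCompletionIntegers K) (r : NumberField.RingOfIntegers K)
    (h : IsLocalRing.residue (v.adicCompletionIntegers K) a =
      Summit.Ventures.HodgeRepro2.T5AdicCompletionResidueField.residueMap (K := K) v r) :
    IsLocalRing.residue (w.adicCompletionIntegers L)
      (algebraMap (v.adicCompletionIntegers K) (w.adicCompletionIntegers L) a) =
    Summit.Ventures.HodgeRepro2.T5AdicCompletionResidueField.residueMap (K := L) w
      (algebraMap (NumberField.RingOfIntegers K) (NumberField.RingOfIntegers L) r) := by
  change _ = IsLocalRing.residue (w.adicCompletionIntegers L)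
    (algebraMap (NumberField.RingOfIntegers L) (w.adicCompletionIntegers L) _)
  rw [← algebraMap_algebraMap_ringOfIntegers v w r]
  change Ideal.Quotient.mk _ _ = Ideal.Quotient.mk _ _
  rw [Ideal.Quotient.eq, ← map_sub]
  apply algebraMap_mem_maximalIdeal
  change Ideal.Quotient.mk _ a = Ideal.Quotient.mk _ _ at h
  rw [Ideal.Quotient.eq] at h
  exact h

/-- THE LOCAL INERTIA DEGREE IS THE GLOBAL ONE: `(ϖ).inertiaDeg' (π) = f(w∣v)` — the residue extension of the completions
is the residue extension of the number fields (row 77's isomorphisms, compatibly). -/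
theorem inertiaDeg'_span_eq {ϖ : v.adicCompletionIntegers K} (hϖ : Irreducible ϖ)
    {π : w.adicCompletionIntegers L} (hπ : Irreducible π) :
    (Ideal.span {ϖ}).inertiaDeg' (Ideal.span {π}) = v.asIdeal.inertiaDeg' w.asIdeal := by
  haveI hlo : (Ideal.span {π}).LiesOver (Ideal.span {ϖ}) := ⟨(comap_span_eq v w hϖ hπ).symm⟩
  rw [Ideal.inertiaDeg'_algebraMap, Ideal.inertiaDeg'_algebraMap]
  -- the residue-field isomorphisms
  let i : (v.adicCompletionIntegers K ⧸ Ideal.span {ϖ}) ≃+* (NumberField.RingOfIntegers K ⧸ v.asIdeal) :=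
    (Ideal.quotEquivOfEq hϖ.maximalIdeal_eq.symm).trans
      (Summit.Ventures.HodgeRepro2.T5AdicCompletionResidueField.quotientEquivResidueField (K := K) v).symm
  let j : (w.adicCompletionIntegers L ⧸ Ideal.span {π}) ≃+* (NumberField.RingOfIntegers L ⧸ w.asIdeal) :=
    (Ideal.quotEquivOfEq hπ.maximalIdeal_eq.symm).trans
      (Summit.Ventures.HodgeRepro2.T5AdicCompletionResidueField.quotientEquivResidueField (K := L) w).symm
  refine Algebra.finrank_eq_of_equiv_equiv i j ?_
  ext a
  obtain ⟨r, hr⟩ := Summit.Ventures.HodgeRepro2.T5AdicCompletionResidueField.residueMap_surjective (K := K) v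
    (IsLocalRing.residue (v.adicCompletionIntegers K) a)
  have hi : i (Ideal.Quotient.mk _ a) = Ideal.Quotient.mk v.asIdeal r := by
    show (Summit.Ventures.HodgeRepro2.T5AdicCompletionResidueField.quotientEquivResidueField (K := K) v).symm
      (Ideal.quotEquivOfEq hϖ.maximalIdeal_eq.symm (Ideal.Quotient.mk _ a)) = _
    rw [Ideal.quotEquivOfEq_mk, RingEquiv.symm_apply_eq]
    exact hr.symm
  have hj : j (Ideal.Quotient.mk _ (algebraMap (v.adicCompletionIntegers K) (w.adicCompletionIntegers L) a)) =
      Ideal.Quotient.mk w.asIdeal (algebraMap (NumberField.RingOfIntegers K) (NumberField.RingOfIntegers L) r) := by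
    show (Summit.Ventures.HodgeRepro2.T5AdicCompletionResidueField.quotientEquivResidueField (K := L) w).symm
      (Ideal.quotEquivOfEq hπ.maximalIdeal_eq.symm (Ideal.Quotient.mk _ _)) = _
    rw [Ideal.quotEquivOfEq_mk, RingEquiv.symm_apply_eq]
    exact residue_algebraMap v w a r hr.symm
  simp only [RingHom.comp_apply, RingEquiv.toRingHom_eq_coe, RingEquiv.coe_toRingHom, hi,
    Ideal.Quotient.algebraMap_mk_of_liesOver, hj]

/-! ### The identity -/

/-- THE FUNDAMENTAL IDENTITY FOR COMPLETIONS: `[L_w : K_v] = e(w∣v) · f(w∣v)`. -/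
theorem finrank_eq_ramificationIdx'_mul_inertiaDeg' :
    Module.finrank (v.adicCompletion K) (w.adicCompletion L) =
      v.asIdeal.ramificationIdx' w.asIdeal * v.asIdeal.inertiaDeg' w.asIdeal := by
  obtain ⟨ϖ, hϖ⟩ := Summit.Ventures.HodgeRepro2.T5AdicCompletionConductor.exists_irreducible (K := K) v
  obtain ⟨π, hπ⟩ := Summit.Ventures.HodgeRepro2.T5AdicCompletionConductor.exists_irreducible (K := L) w
  rw [← Summit.Ventures.HodgeRepro2.T5RamifiedQuadraticDictionary.ramificationIdx'_mul_inertiaDeg'_eq_finrank _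
    (v.adicCompletion K) (w.adicCompletion L) _ ϖ hϖ π hπ, ramificationIdx'_span_eq v w hϖ hπ,
    inertiaDeg'_span_eq v w hϖ hπ]

end Summit.Ventures.HodgeRepro2.T5CompletionFundamentalIdentity
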